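import Summits.FinalStateConjecture.FinalStateConjecture.Theorems.DissipativeFinalMotionsDispersingCaptureStubCaptureOfSettled
import Literature.Geometry.Lorentzian.FinalEraRestFrameSettling
import HarnessLib

/-!
# Stub C′ `stub_captureOfSettledOn` — capture of a dispersing era settled in its rest frames (predicate form)
# (crux `DispersingCapture`, stmt-FinalStateConjecture-17643, line `registered`, skeleton r8; lead prover c3, 2026-08-17)

Route `DissipativeFinalMotions` of the summit `FinalStateConjecture`. The predicate-level form of the landed stub
C `stub_captureOfSettled` (p154603): its ten data hypotheses are exactly the clauses of the Literature predicate
`CauchyDevelopment.IsRestFrameSettledOn 𝒟 N M a T₁ ξ B Ψ O U₁ Φ₀ ρ R`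
(`Literature/Geometry/Lorentzian/FinalEraRestFrameSettling.lean`, p154854: settled charts on a THINNED flat
domain `U₁` with flat chart `Φ₀` after `T₁`, tube profile `ρ`, honest radii `R`). Hence: for every vacuum
Cauchy development, every rev-2 final era `IsFinalEra₂ …` that is rest-frame settled on some `(T₁, U₁, Φ₀, ρ, R)`,
satisfies (R) and (F), and whose labels pairwise disperse with integrable pairwise escape rates (resp. with
Cesàro velocities), the re-typed Statement's conclusion holds (`stub_captureOfSettledOn`, resp.
`captureOfSettledOn_of_cesaro`). This is, up to the order of two hypotheses, the body of the rev-4 restatement of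
the crux recommended in `Cruxes/DispersingCapture/Lines/birth-c3.md` §4 with the GR input E (escape rates) resp.
the Cesàro velocities as a hypothesis; a planner adopting it closes the restated item by `exact` on these.
The same-chart predicate `IsRestFrameSettled` (p152071) must NOT be used next to the package for `N ≥ 1` (jointly
unsatisfiable with (F2); `Lines/birth-c3.md` §2).

References: Dafermos–Luk arXiv:1710.01722, p. 8 and Conjecture 1; DHRT arXiv:2104.08222, §1; O'Neill 1983,
Ch. 9 and Ch. 14; Marchal–Saari, J. Differential Equations 20 (1976).
-/

set_option linter.dupNamespace false

noncomputable section

open scoped Manifold ContDiff Topology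
open Filter Set Function MeasureTheory Literature.Geometry.Lorentzian

namespace Summit.FinalStateConjecture.FinalStateConjecture.Theorems.DissipativeFinalMotions.DispersingCapture

/-- **Capture of a dispersing era settled in its rest frames, Cesàro form.** On a vacuum Cauchy development,
a rev-2 final era (`IsFinalEra₂`, 31 clauses) which is rest-frame settled on a thinned flat domain
(`IsRestFrameSettledOn … T₁ … U₁ Φ₀ ρ R`: late charts into `O` after `T₁`, sublinear drifting tubes inside
`U₁`, full-slab `C²` flatness of `Φ₀`, honest growing radii with near-zone convergence out to them, region
identity, growing-zone exhaustion, full-slab flat orientation), with (R) `RaysStayInClosure 𝒟 O`, (F) eventual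
future-directedness of `dΨᵢ(V_{Mᵢ,aᵢ})` on every truncated slab, pairwise dispersing labels and Cesàro
velocities `t⁻¹ξᵢ(t) → vᵢ`, `‖vᵢ‖ ≤ V`, settles in the re-typed sense (`∃ O' d`, sub-extremal holes,
`O' = exteriorOf 𝒟 d.charted`, `RaysStayInClosure 𝒟 O'`, `HasExhaustiveCharts d`, `IsFutureOriented d`).
Unbundling of the predicate into `captureOfSettled_of_cesaro` (the region identity (O1) is the body of
`exteriorOf`, definitionally). Dafermos–Luk arXiv:1710.01722, Conjecture 1; DHRT arXiv:2104.08222, §1. -/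
theorem captureOfSettledOn_of_cesaro : open scoped Manifold Topology in ∀ (X : Type) [TopologicalSpace X] [ChartedSpace (EuclideanSpace ℝ (Fin 3)) X] [IsManifold (𝓡 3) ((⊤ : ℕ∞) : WithTop ℕ∞) X] [T2Space X] [SecondCountableTopology X] [ConnectedSpace X], ∀ (D : Literature.Geometry.Lorentzian.InitialDataSet (𝓡 3) X) (𝒟 : Literature.Geometry.Lorentzian.VacuumCauchyDevelopment D) (N : ℕ) (M a : Fin N → ℝ) (T δ V C₁ C₂ ρ₀ κ : ℝ) (ξ : Fin N → ℝ → EuclideanSpace ℝ (Fin 3)) (β : ℝ → ℝ) (U₀ : TopologicalSpace.Opens Literature.Geometry.Lorentzian.E4) (B₀ : Literature.Geometry.Lorentzian.ModelBackground) (B : Fin N → Literature.Geometry.Lorentzian.ModelBackground) (Ψ₀ : B₀.domain → 𝒟.carrier) (Ψ : (i : Fin N) → (B i).domain → 𝒟.carrier) (O : Set 𝒟.carrier) (T₁ : ℝ) (ρ : ℝ → ℝ) (R : Fin N → ℝ → ℝ) (U₁ : TopologicalSpace.Opens Literature.Geometry.Lorentzian.E4) (Φ₀ : (Literature.Geometry.Lorentzian.Minkowski.backgroundOn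 U₁).domain → 𝒟.carrier), 𝒟.toCauchyDevelopment.IsFinalEra₂ N M a T δ V C₁ C₂ ρ₀ κ ξ β U₀ B₀ B Ψ₀ Ψ O → 𝒟.toCauchyDevelopment.IsRestFrameSettledOn N M a T₁ ξ B Ψ O U₁ Φ₀ ρ R → Summit.FinalStateConjecture.RaysStayInClosure 𝒟.toCauchyDevelopment O → (∀ i (ρ' : ℝ), ∀ᶠ τ in Filter.atTop, ∀ x ∈ (B i).truncTimeSlab ρ' τ, 𝒟.toSpacetime.timeOrientation.IsFutureDirected (mfderiv 𝓘(ℝ, Literature.Geometry.Lorentzian.E4) (𝓡 4) (Ψ i) x (Literature.Geometry.Lorentzian.Kerr.timeVector (M i) (a i) x.1))) → (∀ i j, i ≠ j → Filter.Tendsto (fun t ↦ ‖ξ i t - ξ j t‖) Filter.atTop Filter.atTop) → (∀ i, ∃ v : EuclideanSpace ℝ (Fin 3), ‖v‖ ≤ V ∧ Filter.Tendsto (fun t : ℝ ↦ t⁻¹ • ξ i t) Filter.atTop (nhds v)) → ∃ (O' : Set 𝒟.carrier) (d : Literature.Geometry.Lorentzian.FinalStateDecomposition 𝒟.toSpacetime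 O' 2), (∀ i, Literature.Geometry.Lorentzian.Kerr.IsSubextremal (d.mass i) (d.spin i)) ∧ O' = Summit.FinalStateConjecture.exteriorOf 𝒟.toCauchyDevelopment d.charted ∧ Summit.FinalStateConjecture.RaysStayInClosure 𝒟.toCauchyDevelopment O' ∧ Summit.FinalStateConjecture.HasExhaustiveCharts d ∧ Summit.FinalStateConjecture.IsFutureOriented d := by
  intro X _ _ _ _ _ _ D 𝒟 N M a T δ V C₁ C₂ ρ₀ κ ξ β U₀ B₀ B Ψ₀ Ψ O T₁ ρ R U₁ Φ₀ hera hset hrays hholes hdisp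
    hvel
  obtain ⟨hΦ₀, hΨ, hS1, hS2, hS3, hS4, hS5, hO, hS6, hS7⟩ := hset
  exact captureOfSettled_of_cesaro X D 𝒟 N M a T δ V C₁ C₂ ρ₀ κ ξ β U₀ B₀ B Ψ₀ Ψ O T₁ ρ R U₁ Φ₀ hera hΦ₀ hΨ
    hS1 hS2 hS3 hS4 hS5 hO hS6 hS7 hrays hholes hdisp hvel

/-- **C′ — CAPTURE OF A DISPERSING ERA SETTLED IN ITS REST FRAMES** (crux `DispersingCapture`, line
`registered`, registered stub `stub_captureOfSettledOn` of skeleton r8): as `captureOfSettledOn_of_cesaro` with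
the Cesàro velocities replaced by integrable pairwise escape rates `1/‖ξᵢ − ξⱼ‖² ∈ L¹[T, ∞)` (`i ≠ j`), the
output of the GR input E of the line (linear-momentum balance; Chazy–Marchal–Saari rates). Unbundling of the
predicate into the landed C `stub_captureOfSettled` (A + B_sep + B₂a + B₂b). Dafermos–Luk arXiv:1710.01722,
Conjecture 1; Marchal–Saari, J. Differential Equations 20 (1976), 150–186. -/
theorem stub_captureOfSettledOn : open scoped Manifold Topology in ∀ (X : Type) [TopologicalSpace X] [ChartedSpace (EuclideanSpace ℝ (Fin 3)) X] [IsManifold (𝓡 3) ((⊤ : ℕ∞) : WithTop ℕ∞) X] [T2Space X] [SecondCountableTopology X] [ConnectedSpace X], ∀ (D : Literature.Geometry.Lorentzian.InitialDataSet (𝓡 3) X) (𝒟 : Literature.Geometry.Lorentzian.VacuumCauchyDevelopment D) (N : ℕ) (M a : Fin N → ℝ) (T δ V C₁ C₂ ρ₀ κ : ℝ) (ξ : Fin N → ℝ → EuclideanSpace ℝ (Fin 3)) (β : ℝ → ℝ) (U₀ : TopologicalSpace.Opens Literature.Geometry.Lorentzian.E4) (B₀ : Literature.Geometry.Lorentzian.ModelBackground)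 (B : Fin N → Literature.Geometry.Lorentzian.ModelBackground) (Ψ₀ : B₀.domain → 𝒟.carrier) (Ψ : (i : Fin N) → (B i).domain → 𝒟.carrier) (O : Set 𝒟.carrier) (T₁ : ℝ) (ρ : ℝ → ℝ) (R : Fin N → ℝ → ℝ) (U₁ : TopologicalSpace.Opens Literature.Geometry.Lorentzian.E4) (Φ₀ : (Literature.Geometry.Lorentzian.Minkowski.backgroundOn U₁).domain → 𝒟.carrier), 𝒟.toCauchyDevelopment.IsFinalEra₂ N M a T δ V C₁ C₂ ρ₀ κ ξ β U₀ B₀ B Ψ₀ Ψ O → 𝒟.toCauchyDevelopment.IsRestFrameSettledOn N M a T₁ ξ B Ψ O U₁ Φ₀ ρ R → Summit.FinalStateConjecture.RaysStayInClosure 𝒟.toCauchyDevelopment O → (∀ i (ρ' : ℝ), ∀ᶠ τ in Filter.atTop, ∀ x ∈ (B i).truncTimeSlab ρ' τ, 𝒟.toSpacetime.timeOrientation.IsFutureDirected (mfderiv 𝓘(ℝ, Literature.Geometry.Lorentzian.E4) (𝓡 4) (Ψ i) x (Literature.Geometry.Lorentzian.Kerr.timeVector (M i) (a i) x.1))) →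 (∀ i j, i ≠ j → Filter.Tendsto (fun t ↦ ‖ξ i t - ξ j t‖) Filter.atTop Filter.atTop) → (∀ i j, i ≠ j → MeasureTheory.IntegrableOn (fun t ↦ 1 / ‖ξ i t - ξ j t‖ ^ 2) (Set.Ici T)) → ∃ (O' : Set 𝒟.carrier) (d : Literature.Geometry.Lorentzian.FinalStateDecomposition 𝒟.toSpacetime O' 2), (∀ i, Literature.Geometry.Lorentzian.Kerr.IsSubextremal (d.mass i) (d.spin i)) ∧ O' = Summit.FinalStateConjecture.exteriorOf 𝒟.toCauchyDevelopment d.charted ∧ Summit.FinalStateConjecture.RaysStayInClosure 𝒟.toCauchyDevelopment O' ∧ Summit.FinalStateConjecture.HasExhaustiveCharts d ∧ Summit.FinalStateConjecture.IsFutureOriented d := by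
  intro X _ _ _ _ _ _ D 𝒟 N M a T δ V C₁ C₂ ρ₀ κ ξ β U₀ B₀ B Ψ₀ Ψ O T₁ ρ R U₁ Φ₀ hera hset hrays hholes hdisp
    hesc
  obtain ⟨hΦ₀, hΨ, hS1, hS2, hS3, hS4, hS5, hO, hS6, hS7⟩ := hset
  exact stub_captureOfSettled X D 𝒟 N M a T δ V C₁ C₂ ρ₀ κ ξ β U₀ B₀ B Ψ₀ Ψ O T₁ ρ R U₁ Φ₀ hera hΦ₀ hΨ hS1
    hS2 hS3 hS4 hS5 hO hS6 hS7 hrays hholes hdisp hesc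

end Summit.FinalStateConjecture.FinalStateConjecture.Theorems.DissipativeFinalMotions.DispersingCapture

end
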